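import Summits.BirchSwinnertonDyer.BirchSwinnertonDyer.Theorems.TwoAdicConverseOrdLambdaHalfAtTwoWbarConj
import Summits.BirchSwinnertonDyer.BirchSwinnertonDyer.Theorems.TwoAdicConverseOrdLambdaHalfAtTwoWbarSwap
import Literature.NumberTheory.EllipticCurves.HeegnerPointsKolyvaginConjugation
import HarnessLib

/-!
# Route `TwoAdicConverse` (rung S3), crux `OrdLambdaHalfAtTwo` (item stmt-BirchSwinnertonDyer-19556), line
# `kato-determinant-greenberg-two` (skeleton v3.2 `35652817b5d7`): **registered stub `stub_wbarStepAtTwo` ([C], the `w̄`-step) PROVED**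

Cell `bsd-2adic`, seat `bsd-2adic-conv-1` GEN 26 (`--supports` stmt-BirchSwinnertonDyer-19556; pen RC-325: the cor–Ver road of
cruxtriage-19556-r1-1 GEN 11 Δ1).  STATEMENT (verbatim from the skeleton): for an imaginary quadratic `K`, its cyclotomic `ℤ₂`-extension
`κ_K` (`H = ker κ_K = Gal(K̄/K_∞)`), a place `w ∋ 2`, a discrete `Γ_K`-module `M` of order `2` and a class `c ∈ H¹(H, M)` unramified at
every `v ∤ 2` (all conjugates) all of whose conjugates are STRICT at `w` for Castella's datum `bdpData M 2 w`, every conjugate of `c`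
is unramified at every place `v ∋ 2`.

PROOF (no class field theory).  `M` has trivial action (`smul_eq_self_of_card_eq_two`), so `c = [z]` for a continuous character
`z : H → M`; in the currency of primes of `\bar ℤ_K` (brick L) `z` kills `H ∩ I_𝔓` for `𝔓` above odd places and `H ∩ D_𝔔` for `𝔔`
above `w`.  The places above `2` are `w` and `σ • w` (brick T, `σ ≠ 1` in `Gal(K/ℚ)`).  At `v = w`: `I_𝔔 ≤ D_𝔔`.  At `v = σ • w`:
with `τ̃` the transport of a complex conjugation `c₀ ∈ Γ_ℚ` (a lift of `σ`) and `φ = τ̃⁻¹(·)τ̃`, brick C (`apply_conjGalCMH_eq`: the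
cor–Ver step, resting on brick R2 = «`ℚ_∞` has no quadratic extension unramified at the odd primes and `∞`», itself Kummer + the layer
induction R0/R1) gives `z ∘ φ = z` on `H`, and brick T moves `D_𝔔` (`𝔔` above `σ • w`) into `D_{𝔔'}` with `𝔔'` above `w`, where `z`
vanishes.  Assembled back into the σ-form by brick L.

HONEST FRAMING: the registered stub's statement, proved from tree theorems; no definition, no named fact, no `sorry`; the crux
`OrdLambdaHalfAtTwo`, the line's other stubs and BSD are NOT proved by this.  PARTITION (D-0054): none — RANK axis S3 × X5@2 stratum
(β); types-the-object-of.  References: [cite: Washington1997, §13.1, Prop. 13.2]; [cite: NeukirchANT1999, Ch. I §9];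
[cite: GreenbergLNM1716, §3 Lemma 3.2]; [cite: Brumer1967] (the classical road this replaces).
-/

set_option autoImplicit false
-- the route's Theorems namespace repeats the summit name by design (D-0017 nested layout)
set_option linter.dupNamespace false

noncomputable section

open scoped Classical NumberField Pointwise

namespace Summit.BirchSwinnertonDyer.BirchSwinnertonDyer.Theorems.TwoAdicWbarStep

open Function NumberField IsDedekindDomain Field
  Literature.NumberTheory.GaloisRepresentations Literature.NumberTheory.EllipticCurves
  Literature.NumberTheory.EllipticCurves.Rank1Residual
  Summit.BirchSwinnertonDyer.BirchSwinnertonDyer.Theorems.TwoAdicGreenbergCotorsion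
  Summit.BirchSwinnertonDyer.BirchSwinnertonDyer.Theorems.PrintCFram.HerbrandSelmerToHom
open Literature.NumberTheory.EllipticCurves.GreenbergVatsal2000 (datumStrictSelmer unramifiedKer unramifiedOutside)
open Summit.BirchSwinnertonDyer.Rank1Residual.X11b (AcSelmer.bdpData AcSelmer.strictDatum)

/-- The lift `φ = τ̃⁻¹(·)τ̃` of complex conjugation preserves `H = ker κ_K` for `κ_K` cyclotomic (both `H` and `Gal(ℚ̄/ℚ_∞)` are cut
out by the torsion of the cyclotomic character, and `res ∘ φ = c₀⁻¹ (res ·) c₀`). [cite: Washington1997, §13.1] -/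
theorem conjGalCMH_mem_kerSubgroup {K : Type} [Field K] [NumberField K] {κK : ZpExtension K 2} (hκK : κK.IsCyclotomic)
    {σ : K ≃ₐ[ℚ] K} {c₀ : absoluteGaloisGroup ℚ} (hτ : IsLiftOfAut σ (absGaloisTransport (K := ℚ) (L := K) c₀).toRingEquiv)
    {x : absoluteGaloisGroup K} (hx : x ∈ κK.kerSubgroup) : (hτ.conjGalCMH x : absoluteGaloisGroup K) ∈ κK.kerSubgroup := by
  haveI : NeZero ((2 : ℕ) : ℚ) := ⟨by norm_num⟩
  have hκ : (CyclotomicZp.zpExtension 2).IsCyclotomic := CyclotomicZp.isCyclotomic_zpExtension 2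
  have hHG : ∀ y : absoluteGaloisGroup K, y ∈ κK.kerSubgroup ↔
      absGaloisRestrict ℚ K y ∈ (CyclotomicZp.zpExtension 2).kerSubgroup := fun y ↦ by
    have e1 : κK.kerSubgroup = (CommGroup.torsion ℤ_[2]ˣ).comap (GaloisRep.cyclotomicCharacter K 2).toMonoidHom := hκK
    have e2 : (CyclotomicZp.zpExtension 2).kerSubgroup =
        (CommGroup.torsion ℤ_[2]ˣ).comap (GaloisRep.cyclotomicCharacter ℚ 2).toMonoidHom := hκ
    rw [e1, e2, Subgroup.mem_comap, Subgroup.mem_comap]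
    change GaloisRep.cyclotomicCharacter K 2 y ∈ _ ↔ GaloisRep.cyclotomicCharacter ℚ 2 (absGaloisRestrict ℚ K y) ∈ _
    rw [cyclotomicCharacter_absGaloisRestrict ℚ K 2 y]
  rw [hHG, absGaloisRestrict_conjGalCMH_of_absGaloisTransport hτ c₀ (fun _ ↦ rfl) x]
  have h := (ZpExtension.kerSubgroup_normal (CyclotomicZp.zpExtension 2)).conj_mem _ ((hHG x).mp hx) c₀⁻¹
  rwa [inv_inv] at h

set_option synthInstance.maxHeartbeats 100000 in
-- the pointwise `MulAction` of `Γ_K` on the ideals of `\bar ℤ_K` is found slowly under these imports (as in `…SelmerToHomPrimes`)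
/-- **Registered stub `stub_wbarStepAtTwo` of line `kato_determinant_greenberg_two` (crux `OrdLambdaHalfAtTwo`,
stmt-BirchSwinnertonDyer-19556), statement verbatim.**  For an imaginary quadratic `K`, its cyclotomic `ℤ₂`-extension, `w ∣ 2` and a
discrete `Γ_K`-module `M` of order `2`: a class of `H¹(K_∞, M)` unramified at every `v ∤ 2` and STRICT at `w` (all conjugates, Castella's
datum) is unramified at EVERY place above `2`.  Proof: cor–Ver road (bricks R0/R1/R2, L, T, C of this seat), no class field theory.
[cite: Washington1997, §13.1] [cite: NeukirchANT1999, Ch. I §9 (9.1), (9.4)] -/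
theorem stub_wbarStepAtTwo :
    ∀ (K : Type) [Field K] [NumberField K], IsImaginaryQuadratic K →
      ∀ (κK : ZpExtension K 2), κK.IsCyclotomic →
      ∀ (w : HeightOneSpectrum (𝓞 K)) (hw : ((2 : ℕ) : 𝓞 K) ∈ w.asIdeal),
      ∀ (M : Type) [AddCommGroup M] [DistribMulAction (absoluteGaloisGroup K) M]
        [TopologicalSpace M] [DiscreteTopology M], Nat.card M = 2 →
      ∀ c : subgroupH1 κK.kerSubgroup M, c ∈ unramifiedOutside κK.kerSubgroup M 2 ∅ →
        (∀ σ : absoluteGaloisGroup K, conjH1 κK.kerSubgroup M σ c ∈ (AcSelmer.bdpData M 2 w w hw).strictKer κK.kerSubgroup) →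
        ∀ (v : HeightOneSpectrum (𝓞 K)), ((2 : ℕ) : 𝓞 K) ∈ v.asIdeal →
          ∀ σ : absoluteGaloisGroup K, conjH1 κK.kerSubgroup M σ c ∈ unramifiedKer κK.kerSubgroup M v := by
  intro K _ _ hK κK hκK w hw M _ _ _ _ hM c hunr hstr v hv σ₀
  have htriv : ∀ (σ : absoluteGaloisGroup K) (m : M), σ • m = m := smul_eq_self_of_card_eq_two hM
  obtain ⟨z, rfl⟩ := oneCocycleClass_surjective _ c
  -- the hypotheses, prime by prime (brick L)
  have hI : ∀ u : HeightOneSpectrum (𝓞 K), ((2 : ℕ) : 𝓞 K) ∉ u.asIdeal → ∀ 𝔓 ∈ u.primesAbove,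
      ∀ (n : absoluteGaloisGroup K) (hnH : n ∈ κK.kerSubgroup), n ∈ 𝔓.inertia (absoluteGaloisGroup K) → z.1 ⟨n, hnH⟩ = 0 :=
    fun u hu 𝔓 h𝔓 n hnH hn ↦ apply_eq_zero_of_forall_conjH1_mem_unramifiedKer κK.kerSubgroup htriv z
      (fun σ ↦ (GreenbergVatsal2000.mem_unramifiedOutside_iff _).1 hunr u (Set.notMem_empty u) hu σ) h𝔓 hnH hn
  have hD : ∀ 𝔔 ∈ w.primesAbove, ∀ (n : absoluteGaloisGroup K) (hnH : n ∈ κK.kerSubgroup),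
      n ∈ 𝔔.decompositionSubgroup (absoluteGaloisGroup K) → z.1 ⟨n, hnH⟩ = 0 :=
    fun 𝔔 h𝔔 n hnH hn ↦ apply_eq_zero_of_forall_conjH1_mem_strictKer_bdpData κK.kerSubgroup htriv z hw hstr h𝔔 hnH hn
  -- the goal, prime by prime
  refine conjH1_mem_unramifiedKer_of_forall_primesAbove κK.kerSubgroup htriv z ?_ σ₀
  intro 𝔔 h𝔔 n hnH hnI
  have hnD : n ∈ 𝔔.decompositionSubgroup (absoluteGaloisGroup K) := Ideal.inertia_le_decompositionSubgroup _ _ hnI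
  -- the swap `w ↔ σ • w` by a lift of complex conjugation
  obtain ⟨σ, hσ1, -⟩ := hK.exists_algEquiv_ne_one_mul_self
  obtain ⟨c₀, hc₀⟩ := exists_isComplexConjugation (Rat.castHom ℝ)
  have hτ := RatClosure.isLiftOfAut_absGaloisTransport_of_isImaginaryQuadratic hK hσ1 hc₀
  rcases eq_or_eq_smul_of_natCast_mem hK hσ1 Nat.prime_two hv hw with rfl | hvw
  · exact hD 𝔔 h𝔔 n hnH hnD
  · obtain ⟨𝔔', h𝔔', hD'⟩ := exists_primesAbove_smul_forall_conjGalCMH_mem hτ h𝔔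
    rw [hvw, inv_smul_smul] at h𝔔'
    have hφn : (hτ.conjGalCMH n : absoluteGaloisGroup K) ∈ κK.kerSubgroup := conjGalCMH_mem_kerSubgroup hκK hτ hnH
    rw [← apply_conjGalCMH_eq hK hκK hM htriv z hI hc₀ hτ n hnH hφn]
    exact hD 𝔔' h𝔔' _ hφn (hD' n hnD)

end Summit.BirchSwinnertonDyer.BirchSwinnertonDyer.Theorems.TwoAdicWbarStep

end
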